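import Summits.HubbardSuperconductivity.HubbardSuperconductivity.Theorems.AnisotropyChordTransferFibre3N1Row
import Summits.HubbardSuperconductivity.HubbardSuperconductivity.Theorems.AnisotropyChordTransferFibre3B1Instances
import Summits.HubbardSuperconductivity.HubbardSuperconductivity.Theorems.AnisotropyChordTransferFibre3CosWeighted

/-!
# Route `AnisotropyChord` / H0 rotor rung, LEVEL 2 row `N₁` (PartN41-B §4): the REDUCTIONS of weighted one-propagator sums

PORT PartN41-B (`…Fibre3N1Row`, theory-1 g22, memo 22 §335) reduces every `cos kₓ`- or `E`-weighted one-propagator sum of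
the closed expansions (§5) and outer majorants (§6) to the named power sums `S₁…S₄`.  This file discharges §4:
* `energyTimesPropagator_holds : EnergyTimesPropagator L` — `E(k)·g(k) = 1 + λ₂ g(k)` off `k = 0`;
* `cosWeightedReduction_holds : CosWeightedReduction L` — `Σ g^j cos kₓ = (1 − λ₂/4)S_j − S_{j−1}/4` (`j = 2,3,4`) and
  `Σ g cos kₓ = (1 − λ₂/4)S₁ − (V − 1)/4` (x↔y symmetry of `g`, `cos kₓ + cos k_y = 2 − ε(k)`, `E g = 1 + λ₂g`);
* `shiftedEnergyReduction_holds : ShiftedEnergyReduction L` — `Σ_{k ∈ T′} g(k + K₁)^j E(k)`, `j = 1, 2`, in named form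
  (shift `k ↦ k − K₁`, the addition formula for `cos(kₓ − θ)`, the vanishing sine sum `Σ g^j sin kₓ = 0`, and the fact that the
  two excluded points contribute `0`).
Tools: `S1n_eq … S4n_eq` (the named sums unfolded), `gres_swap`, `sum_pow_cos_eq`, `gres_mul_epsT`, p1 g26's
`KT1Assembly.sum_gpow_cos_swap` (`…Fibre3CosWeighted`, the x↔y symmetry),
`sin_two_pi_val_intCast`, `sum_pow_sin_eq_zero`, `epsT_sub_K1`.
Prover seat `hubbard-h0-rotor-p2` g4; helper for piece A = stmt-HubbardSuperconductivity-23918 of rung 19089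
(`--supports`, helper class).  Nothing here proves superconductivity in the Hubbard model; helper lemmas of ONE conditional
reduction (the GM₃ ∀L certificate, Level-2 row `N₁`); the rotor TARGET as originally worded stays FALSE (g15 verdict).
Mathlib + the tree only; no sorry.
-/

set_option linter.dupNamespace false
set_option autoImplicit false

noncomputable section

open scoped BigOperators

namespace Summit.HubbardSuperconductivity.HubbardSuperconductivity.Theorems.AnisotropyChord.Transfer.Fibre3

variable (L : ℕ) [NeZero L]

/-! ## The named power sums unfolded -/

/-- one-factor `B1.torSum` with no shift is the plain power sum. [folklore] -/
theorem torSum_one (lam2 : ℝ) (j : ℕ) :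
    B1.torSum L lam2 ![((0 : ℤ), (0 : ℤ))] ![j] = ∑ k : Tor L, gres L lam2 k ^ j := by
  unfold B1.torSum
  refine Finset.sum_congr rfl fun k _ => ?_
  simp [B1.toTor, Prod.mk_zero_zero]

/-- `S₁ = Σ_k g(k)`. [folklore] -/
theorem S1n_eq (lam2 : ℝ) : S1n L lam2 = ∑ k : Tor L, gres L lam2 k := by
  unfold S1n; rw [torSum_one]; simp

/-- `S₂ = Σ_k g(k)²`. [folklore] -/
theorem S2n_eq (lam2 : ℝ) : S2n L lam2 = ∑ k : Tor L, gres L lam2 k ^ 2 := by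
  unfold S2n; rw [torSum_one]

/-- `S₃ = Σ_k g(k)³`. [folklore] -/
theorem S3n_eq (lam2 : ℝ) : S3n L lam2 = ∑ k : Tor L, gres L lam2 k ^ 3 := by
  unfold S3n; rw [torSum_one]

/-- `S₄ = Σ_k g(k)⁴`. [folklore] -/
theorem S4n_eq (lam2 : ℝ) : S4n L lam2 = ∑ k : Tor L, gres L lam2 k ^ 4 := by
  unfold S4n; rw [torSum_one]

/-! ## `E·g = 1 + λ₂ g` -/

omit [NeZero L] in
/-- ★ **`EnergyTimesPropagator` holds**: `E(k) g(k) = 1 + λ₂ g(k)` for `k ≠ 0`, `2ε(k) ≠ λ₂`. -/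
theorem energyTimesPropagator_holds : EnergyTimesPropagator L := by
  intro lam2 k hk hne
  unfold EK gres
  rw [if_neg hk]
  field_simp
  ring

omit [NeZero L] in
/-- pointwise: `g(k)·ε(k) = (𝟙[k ≠ 0] + λ₂ g(k))/2` (regular `λ₂`). [folklore] -/
theorem gres_mul_epsT (lam2 : ℝ) (hreg : ∀ k : Tor L, k ≠ 0 → 2 * epsT L k - lam2 ≠ 0) (k : Tor L) :
    gres L lam2 k * epsT L k = ((if k = 0 then (0 : ℝ) else 1) + lam2 * gres L lam2 k) / 2 := by
  unfold gres
  by_cases hk : k = 0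
  · simp [hk]
  · rw [if_neg hk, if_neg hk]
    have hne := hreg k hk
    field_simp
    ring

/-! ## The `x ↔ y` symmetry and the cosine weights -/

omit [NeZero L] in
/-- `g(k₂,k₁) = g(k₁,k₂)`. [folklore] -/
theorem gres_swap (lam2 : ℝ) (k : Tor L) : gres L lam2 (k.2, k.1) = gres L lam2 k := by
  unfold gres
  have : ((k.2, k.1) : Tor L) = 0 ↔ k = 0 := by
    constructor
    · intro h
      have h1 := congrArg Prod.fst h
      have h2 := congrArg Prod.snd h
      simp only [Prod.fst_zero, Prod.snd_zero] at h1 h2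
      exact Prod.ext h2 h1
    · intro h; rw [h]; rfl
  simp only [this, epsT_swap]

/-- `Σ_k g^j cos kₓ = Σ_k g^j (1 − ε(k)/2)` (`cos kₓ + cos k_y = 2 − ε`). [folklore] -/
theorem sum_pow_cos_eq (lam2 : ℝ) (j : ℕ) :
    ∑ k : Tor L, gres L lam2 k ^ j * Real.cos (2 * Real.pi * k.1.val / L)
      = ∑ k : Tor L, gres L lam2 k ^ j * (1 - epsT L k / 2) := by
  have h := KT1Assembly.sum_gpow_cos_swap L lam2 j
  have h2 : ∑ k : Tor L, gres L lam2 k ^ j * Real.cos (2 * Real.pi * k.1.val / L)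
      + ∑ k : Tor L, gres L lam2 k ^ j * Real.cos (2 * Real.pi * k.2.val / L)
      = ∑ k : Tor L, gres L lam2 k ^ j * (2 - epsT L k) := by
    rw [← Finset.sum_add_distrib]
    refine Finset.sum_congr rfl fun k _ => ?_
    unfold epsT
    ring
  have h3 : ∑ k : Tor L, gres L lam2 k ^ j * (2 - epsT L k) = 2 * ∑ k : Tor L, gres L lam2 k ^ j * (1 - epsT L k / 2) := by
    rw [Finset.mul_sum]
    refine Finset.sum_congr rfl fun k _ => ?_
    ring
  linarith

/-- the number of torus points is `V = L²` (as a real). [folklore] -/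
theorem sum_indicator_ne_zero : ∑ k : Tor L, (if k = 0 then (0 : ℝ) else 1) = (L : ℝ) ^ 2 - 1 := by
  have e : ∀ k : Tor L, (if k = 0 then (0 : ℝ) else 1) = 1 - (if k = 0 then (1 : ℝ) else 0) := by
    intro k; split_ifs <;> norm_num
  rw [Finset.sum_congr rfl fun k _ => e k, Finset.sum_sub_distrib, Finset.sum_ite_eq' Finset.univ (0 : Tor L)]
  simp only [Finset.mem_univ, if_true, Finset.sum_const, Finset.card_univ, nsmul_eq_mul, mul_one]
  have : Fintype.card (Tor L) = L ^ 2 := by simp [Fintype.card_prod, ZMod.card, sq]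
  rw [this]
  push_cast
  ring

/-- ★ **`CosWeightedReduction` holds.** -/
theorem cosWeightedReduction_holds : CosWeightedReduction L := by
  intro lam2 hreg
  have hg := gres_mul_epsT L lam2 hreg
  -- the generic power step: `Σ g^{m+2} cos kₓ = (1 − λ/4) S_{m+2} − S_{m+1}/4`
  have hpow : ∀ m : ℕ, ∑ k : Tor L, gres L lam2 k ^ (m + 2) * Real.cos (2 * Real.pi * k.1.val / L)
      = (1 - lam2 / 4) * (∑ k : Tor L, gres L lam2 k ^ (m + 2)) - (∑ k : Tor L, gres L lam2 k ^ (m + 1)) / 4 := by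
    intro m
    rw [sum_pow_cos_eq, Finset.mul_sum, Finset.sum_div, ← Finset.sum_sub_distrib]
    refine Finset.sum_congr rfl fun k _ => ?_
    have hk := hg k
    have e : gres L lam2 k ^ (m + 2) * (1 - epsT L k / 2)
        = gres L lam2 k ^ (m + 2) - gres L lam2 k ^ (m + 1) * (gres L lam2 k * epsT L k) / 2 := by ring
    rw [e, hk]
    by_cases h0 : k = 0
    · subst h0
      simp [gres]
    · rw [if_neg h0]
      ring
  refine ⟨?_, ?_, ?_, ?_⟩
  · -- j = 1
    have h1 := sum_pow_cos_eq L lam2 1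
    simp only [pow_one] at h1
    rw [S1n_eq, h1, Finset.mul_sum]
    have e : ∀ k : Tor L, gres L lam2 k * (1 - epsT L k / 2)
        = (1 - lam2 / 4) * gres L lam2 k - (if k = 0 then (0 : ℝ) else 1) / 4 := by
      intro k
      have hk := hg k
      have e1 : gres L lam2 k * (1 - epsT L k / 2) = gres L lam2 k - (gres L lam2 k * epsT L k) / 2 := by ring
      rw [e1, hk]
      ring
    rw [Finset.sum_congr rfl fun k _ => e k, Finset.sum_sub_distrib, ← Finset.sum_div, sum_indicator_ne_zero]
  · rw [S2n_eq, S1n_eq, hpow 0]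
    simp
  · rw [S3n_eq, S2n_eq, hpow 1]
  · rw [S4n_eq, S3n_eq, hpow 2]

/-! ## The shifted energy sums -/

/-- `sin(2π·val(z)/L) = sin(2π z/L)` for an integer `z` read in `ZMod L`. [folklore] -/
theorem sin_two_pi_val_intCast (z : ℤ) :
    Real.sin (2 * Real.pi * (((z : ZMod L)).val : ℝ) / L) = Real.sin (2 * Real.pi * (z : ℝ) / L) := by
  have hL : (L : ℝ) ≠ 0 := by exact_mod_cast NeZero.ne L
  have h1 : ((((z : ZMod L)).val : ℕ) : ℤ) = z % (L : ℤ) := ZMod.val_intCast z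
  have h2 : (((z : ZMod L)).val : ℝ) = ((z % (L : ℤ) : ℤ) : ℝ) := by
    have := congrArg (fun t : ℤ => (t : ℝ)) h1
    simpa using this
  set w : ℤ := z / (L : ℤ) with hw
  rw [h2, Int.emod_def, ← hw]
  push_cast
  have e : 2 * Real.pi * ((z : ℝ) - (L : ℝ) * (w : ℝ)) / L = 2 * Real.pi * (z : ℝ) / L - (w : ℝ) * (2 * Real.pi) := by
    field_simp
  rw [e]
  exact Real.sin_sub_int_mul_two_pi _ _

/-- the vanishing sine sum: `Σ_k g(k)^j sin kₓ = 0` (`g` even, `sin` odd). [folklore] -/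
theorem sum_pow_sin_eq_zero (lam2 : ℝ) (j : ℕ) :
    ∑ k : Tor L, gres L lam2 k ^ j * Real.sin (2 * Real.pi * k.1.val / L) = 0 := by
  set F : Tor L → ℝ := fun k => gres L lam2 k ^ j * Real.sin (2 * Real.pi * k.1.val / L) with hF
  have hodd : ∀ k : Tor L, F (-k) = -F k := by
    intro k
    rw [hF]
    dsimp only
    rw [B1.gres_neg]
    have e1 : (-k).1 = (((-(k.1.valMinAbs) : ℤ)) : ZMod L) := by simp [ZMod.coe_valMinAbs]
    have e2 : k.1 = (((k.1.valMinAbs : ℤ)) : ZMod L) := (ZMod.coe_valMinAbs k.1).symm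
    rw [e1, sin_two_pi_val_intCast]
    conv_rhs => rw [e2, sin_two_pi_val_intCast]
    push_cast
    rw [show 2 * Real.pi * -((k.1.valMinAbs : ℤ) : ℝ) / L = -(2 * Real.pi * ((k.1.valMinAbs : ℤ) : ℝ) / L) by ring,
      Real.sin_neg]
    ring
  have h := Fintype.sum_equiv (Equiv.neg (Tor L)) F (fun k => -F k) fun k => by
    simp only [Equiv.neg_apply]
    rw [← hodd, neg_neg]
  rw [Finset.sum_neg_distrib] at h
  show ∑ k : Tor L, F k = 0
  linarith

/-- the dispersion shifted by `−K₁`: `ε(k − K₁) = 2 − cos θ cos kₓ − sin θ sin kₓ − cos k_y`, `θ = 2π/L`. [folklore] -/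
theorem epsT_sub_K1 (k : Tor L) :
    epsT L (k - K1 L)
      = 2 - Real.cos (2 * Real.pi / L) * Real.cos (2 * Real.pi * k.1.val / L)
          - Real.sin (2 * Real.pi / L) * Real.sin (2 * Real.pi * k.1.val / L)
          - Real.cos (2 * Real.pi * k.2.val / L) := by
  unfold epsT K1
  have e1 : (k - ((1 : ZMod L), 0)).1 = ((((k.1.valMinAbs : ℤ) - 1 : ℤ)) : ZMod L) := by
    simp [ZMod.coe_valMinAbs]
  have e2 : (k - ((1 : ZMod L), 0)).2 = k.2 := by simp
  have e3 : k.1 = (((k.1.valMinAbs : ℤ)) : ZMod L) := (ZMod.coe_valMinAbs k.1).symm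
  rw [e1, e2, cos_two_pi_val_intCast]
  conv_rhs => rw [e3, cos_two_pi_val_intCast, sin_two_pi_val_intCast]
  push_cast
  rw [show 2 * Real.pi * (((k.1.valMinAbs : ℤ) : ℝ) - 1) / L
      = 2 * Real.pi * ((k.1.valMinAbs : ℤ) : ℝ) / L - 2 * Real.pi / L by field_simp, Real.cos_sub]
  ring

/-- the shifted energy sum over all of `(ℤ/L)²`: `Σ_k g(k)^j E(k − K₁) = 4S_j − 2cos θ·C_j − 2C_j` (`j ≥ 1`;
`C_j = Σ g^j cos kₓ`). [folklore] -/
theorem sum_pow_EK_sub_K1 (lam2 : ℝ) (j : ℕ) :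
    ∑ k : Tor L, gres L lam2 k ^ j * EK L (k - K1 L)
      = 4 * (∑ k : Tor L, gres L lam2 k ^ j)
        - 2 * Real.cos (2 * Real.pi / L) * (∑ k : Tor L, gres L lam2 k ^ j * Real.cos (2 * Real.pi * k.1.val / L))
        - 2 * (∑ k : Tor L, gres L lam2 k ^ j * Real.cos (2 * Real.pi * k.1.val / L)) := by
  have hs := sum_pow_sin_eq_zero L lam2 j
  have hy := KT1Assembly.sum_gpow_cos_swap L lam2 j
  unfold EK
  have e : ∀ k : Tor L, gres L lam2 k ^ j * (2 * epsT L (k - K1 L))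
      = 4 * gres L lam2 k ^ j
        - 2 * Real.cos (2 * Real.pi / L) * (gres L lam2 k ^ j * Real.cos (2 * Real.pi * k.1.val / L))
        - 2 * Real.sin (2 * Real.pi / L) * (gres L lam2 k ^ j * Real.sin (2 * Real.pi * k.1.val / L))
        - 2 * (gres L lam2 k ^ j * Real.cos (2 * Real.pi * k.2.val / L)) := by
    intro k; rw [epsT_sub_K1]; ring
  rw [Finset.sum_congr rfl fun k _ => e k]
  simp only [Finset.sum_sub_distrib, ← Finset.mul_sum]
  rw [hs, ← hy]
  ring

/-- the restricted sum equals the full one: the two excluded points `k = 0` (`E(0)·… `) hmm — precisely: on `T′ᶜ = {0, −K₁}` the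
summand `g(k+K₁)^j E(k)` vanishes (`E(0) = 0`, `g(0) = 0`, `j ≥ 1`). [folklore] -/
theorem sum_torPrime_eq_univ (lam2 : ℝ) (j : ℕ) (hj : 1 ≤ j) :
    ∑ k ∈ torPrime L, gres L lam2 (k + K1 L) ^ j * EK L k = ∑ k : Tor L, gres L lam2 (k + K1 L) ^ j * EK L k := by
  classical
  unfold torPrime
  apply Finset.sum_subset (Finset.filter_subset _ _)
  intro k _ hk
  rw [Finset.mem_filter, not_and_or] at hk
  rcases hk with hk | hk
  · exact absurd (Finset.mem_univ k) hk
  · rw [not_and_or, not_ne_iff, not_ne_iff] at hk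
    rcases hk with hk | hk
    · -- k = 0: E(0) = 0
      have hE : EK L 0 = 0 := by
        unfold EK epsT
        simp only [Prod.fst_zero, Prod.snd_zero, ZMod.val_zero, Nat.cast_zero, mul_zero, zero_div, Real.cos_zero]
        ring
      rw [hk, hE, mul_zero]
    · -- k + K₁ = 0: g(0) = 0
      rw [hk]
      unfold gres
      rw [if_pos rfl, zero_pow (by omega), zero_mul]

/-- ★ **`ShiftedEnergyReduction` holds.** -/
theorem shiftedEnergyReduction_holds : ShiftedEnergyReduction L := by
  intro lam2 hreg
  have hsc := Real.sin_sq_add_cos_sq (2 * Real.pi / L)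
  -- reindex `k ↦ k − K₁`
  have hre : ∀ j : ℕ, ∑ k : Tor L, gres L lam2 (k + K1 L) ^ j * EK L k = ∑ k : Tor L, gres L lam2 k ^ j * EK L (k - K1 L) := by
    intro j
    refine (Fintype.sum_equiv (Equiv.subRight (K1 L)) _ _ fun k => ?_).symm
    simp only [Equiv.subRight_apply, sub_add_cancel]
  refine ⟨?_, ?_⟩
  · have h1 := sum_torPrime_eq_univ L lam2 1 le_rfl
    have h2 := hre 1
    have h3 := sum_pow_EK_sub_K1 L lam2 1
    simp only [pow_one] at h1 h2 h3
    rw [h1, h2, h3, S1n_eq]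
    linear_combination (-2 * gres L lam2 (K1 L)) * hsc
  · rw [sum_torPrime_eq_univ L lam2 2 (by norm_num), hre 2, sum_pow_EK_sub_K1, S2n_eq]
    linear_combination (-2 * gres L lam2 (K1 L) ^ 2) * hsc

end Summit.HubbardSuperconductivity.HubbardSuperconductivity.Theorems.AnisotropyChord.Transfer.Fibre3

end
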